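import Literature.NumberTheory.Transcendental.CyclotomicSimplexRep
import Mathlib.LinearAlgebra.Finsupp.LinearCombination
import Mathlib.LinearAlgebra.Span.Defs
import HarnessLib
import Summits.KontsevichZagierPeriods.KontsevichZagierPeriods.Theorems.OctahedralSymmetryOctahedralSpanAllWeightsDefs

/-!
# Crux `OctahedralSpanAllWeights` (stmt-KontsevichZagierPeriods-9659), line `Sketch`: stub `StubElimGt`

Block E1 of the unit-pole filtration argument for the two-letter normal form of convergent level-4
words (route `OctahedralSymmetry`, problem `KontsevichZagierPeriods`).

## What is proved

`stub_elim_gt`: for a convergent word `W : List (Fin 5)` with `#4(W) < #0(W)` (more letters `0` =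
pole `1`, the form `dt/(t−1)`, than letters `4` = pole `0`), `[W] ∈ rel ⊔ lowerSpan W`, i.e. modulo
the relation module `rel` the word is a `ℚ`-combination of convergent words of the same length
with strictly fewer letters `0`.

## How

One involution generator suffices, in every weight: `invGen W = [W] − sigmaSubst W ∈ rel`
(`IsGen.inv`), so `[W] = invGen W + toQ (sigmaSubst W)` and it remains to see
`toQ (sigmaSubst W) ∈ lowerSpan W`. By definition
`sigmaSubst W = (-1)^{|W|} • ofTerms ((expand sigmaLetter W).map (c, V) ↦ (c, reverse V))`, and
`toQ (ofTerms L)` lies in the span of the words of `L` (`toQ_ofTerms_mem_span`). The combinatorics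
of `expand` (`forall₂_of_mem_expand`): every expanded word `V` is related to `W` letter by letter,
the `j`-th letter of `V` being a letter of `sigmaLetter (W j)`. In Zhao's table
`0 ↦ [4] − [2]`, `1 ↦ [3] − [2]`, `2 ↦ −[2]`, `3 ↦ [1] − [2]`, `4 ↦ [0] − [2]` the letter `0` occurs
only in `sigmaLetter 4` and the letter `4` only in `sigmaLetter 0` (both by `decide`); hence
`#0(reverse V) = #0(V) ≤ #4(W) < #0(W)`, and `reverse V` is convergent: its first letter is the last
letter of `V`, which comes from the last letter `≠ 4` of `W`, so it is `≠ 0`; its last letter is the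
first letter of `V`, which comes from the first letter `≠ 0` of `W`, so it is `≠ 4`.

## Sources

J. Zhao, *Multiple polylogarithm values at roots of unity*, C. R. Acad. Sci. Paris 346 (2008), §4
(the octahedral involution `σ(t) = (1−t)/(1+t)`, `σ^*ω_a = ω_{σ a} − ω_{−1}`) [Zhao2008]; J. Zhao,
*Standard relations of multiple polylogarithm values at roots of unity*, Doc. Math. 15 (2010), §2
[Zhao2010]. The filtration by the number of unit poles is folklore bookkeeping on this table.
-/

noncomputable section

namespace Summit.KontsevichZagierPeriods.OctahedralSymmetry.OctaSpan

open Literature.NumberTheory.Transcendental Literature.NumberTheory.Transcendental.LevelFour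

/-! ### Stub E1: helper lemmas on the `σ`-expansion -/

/-- `toQ` of a term list all of whose words lie in `S` lies in the `ℚ`-span of `[V]`, `V ∈ S`
(`toQ (ofTerms L) = ∑ c • [V]`). [folklore] -/
private theorem toQ_ofTerms_mem_span {S : Set (List (Fin 5))} :
    ∀ L : List (ℤ × List (Fin 5)), (∀ p ∈ L, p.2 ∈ S) →
      toQ (ofTerms L) ∈ Submodule.span ℚ (sym '' S)
  | [], _ => by simp
  | p :: L, hL => by
    rw [ofTerms_cons, map_add, toQ_single]
    have hp : sym p.2 ∈ Submodule.span ℚ (sym '' S) :=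
      Submodule.subset_span (Set.mem_image_of_mem sym (hL p (by simp)))
    exact Submodule.add_mem _ (zsmul_mem hp _)
      (toQ_ofTerms_mem_span L fun q hq => hL q (by simp [hq]))

/-- The words of the multilinear expansion `expand φ W` arise from `W` letter by letter: the `j`-th
letter of an expanded word is one of the letters of `φ (W j)`. [folklore] -/
private theorem forall₂_of_mem_expand (φ : Fin 5 → List (ℤ × Fin 5)) :
    ∀ (W : List (Fin 5)) {cV : ℤ × List (Fin 5)}, cV ∈ expand φ W →
      List.Forall₂ (fun b a => b ∈ (φ a).map Prod.snd) cV.2 W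
  | [], cV, h => by
    rw [expand_nil, List.mem_singleton] at h
    subst h
    exact List.Forall₂.nil
  | m :: W, cV, h => by
    simp only [expand_cons, List.mem_flatMap, List.mem_map] at h
    obtain ⟨cb, hcb, dV, hdV, rfl⟩ := h
    exact List.Forall₂.cons (List.mem_map.2 ⟨cb, hcb, rfl⟩) (forall₂_of_mem_expand φ W hdV)

/-- In Zhao's table `σ^*ω_a = ω_{σ a} − ω_{−1}` the letter `0` (pole `1`) occurs only in
`σ^*ω₀ = ω₁ − ω_{−1}`, i.e. in `sigmaLetter 4`. [cite: Zhao2008, §4] -/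
private theorem eq_four_of_mem_sigmaLetter_zero :
    ∀ a b : Fin 5, b ∈ (sigmaLetter a).map Prod.snd → b = 0 → a = 4 := by
  decide

/-- In Zhao's table `σ^*ω_a = ω_{σ a} − ω_{−1}` the letter `4` (pole `0`) occurs only in
`σ^*ω₁ = ω₀ − ω_{−1}`, i.e. in `sigmaLetter 0`. [cite: Zhao2008, §4] -/
private theorem eq_zero_of_mem_sigmaLetter_four :
    ∀ a b : Fin 5, b ∈ (sigmaLetter a).map Prod.snd → b = 4 → a = 0 := by
  decide

/-- Along the `σ`-expansion the number of letters `0` of an expanded word is at most the number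
of letters `4` of the source word. [folklore] -/
private theorem count_zero_le_count_four {V W : List (Fin 5)}
    (h : List.Forall₂ (fun b a => b ∈ (sigmaLetter a).map Prod.snd) V W) :
    V.count 0 ≤ W.count 4 := by
  induction h with
  | nil => simp
  | @cons b a V W hba _ ih =>
    rcases eq_or_ne b 0 with rfl | hb
    · obtain rfl : a = 4 := eq_four_of_mem_sigmaLetter_zero a 0 hba rfl
      rw [List.count_cons_self, List.count_cons_self]
      exact Nat.succ_le_succ ih
    · rw [List.count_cons_of_ne hb]
      exact ih.trans List.count_le_count_cons

/-- If the letter `x` of an expanded word can only come from the letter `y` of the source and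
the source does not start with `y`, the expanded word does not start with `x`. [folklore] -/
private theorem head?_ne_of_forall₂ {R : Fin 5 → Fin 5 → Prop} {x y : Fin 5}
    (hR : ∀ a b, R b a → b = x → a = y) {V W : List (Fin 5)} (h : List.Forall₂ R V W)
    (hW : W.head? ≠ some y) : V.head? ≠ some x := by
  cases h with
  | nil => simp
  | @cons b a V W hba _ =>
    simp only [List.head?_cons, ne_eq, Option.some.injEq] at hW ⊢
    exact fun hb => hW (hR a b hba hb)

/-- For a convergent `W` with `#4(W) < #0(W)`, every (reversed) word of the expansion
`expand sigmaLetter W` — i.e. every word of `sigmaSubst W` — is a convergent word of the same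
length with fewer letters `0`. [cite: Zhao2008, §4] -/
private theorem reverse_mem_lowerSet {W : List (Fin 5)} (hW : IsConvergent W)
    (h : W.count 4 < W.count 0) {cV : ℤ × List (Fin 5)} (hcV : cV ∈ expand sigmaLetter W) :
    cV.2.reverse ∈ {V | V.length = W.length ∧ IsConvergent V ∧ V.count 0 < W.count 0} := by
  have hF := forall₂_of_mem_expand sigmaLetter W hcV
  refine ⟨by rw [List.length_reverse, hF.length_eq], ⟨?_, ?_⟩, ?_⟩
  · exact head?_ne_of_forall₂ eq_four_of_mem_sigmaLetter_zero (List.rel_reverse hF)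
      (by rw [List.head?_reverse]; exact hW.2)
  · rw [List.getLast?_reverse]
    exact head?_ne_of_forall₂ eq_zero_of_mem_sigmaLetter_four hF hW.1
  · rw [List.count_reverse]
    exact (count_zero_le_count_four hF).trans_lt h

/-- `toQ (sigmaSubst W) ∈ lowerSpan W` when `W` is convergent and `#4(W) < #0(W)`.
[cite: Zhao2008, §4] -/
private theorem toQ_sigmaSubst_mem_lowerSpan {W : List (Fin 5)} (hW : IsConvergent W)
    (h : W.count 4 < W.count 0) : toQ (sigmaSubst W) ∈ lowerSpan W := by
  unfold sigmaSubst lowerSpan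
  rw [map_zsmul]
  refine zsmul_mem (toQ_ofTerms_mem_span _ fun p hp => ?_) _
  obtain ⟨cV, hcV, rfl⟩ := List.mem_map.1 hp
  exact reverse_mem_lowerSet hW h hcV

/-- **Stub E1 (unit-pole elimination, large block).** A convergent word with more letters `0`
(pole `1`) than letters `4` (pole `0`) lies, modulo `rel`, in the span of the convergent words of the
same length with fewer letters `0`: `[W] − invGen W = sigmaSubst W` and every word of `sigmaSubst W`
has at most `#4(W) < #0(W)` letters `0` (`σ^*ω₀ = ω₁ − ω₋₁` is the only source of the pole `1`).
[cite: Zhao2008, §4] -/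
theorem stub_elim_gt (W : List (Fin 5)) (hW : IsConvergent W) (h : W.count 4 < W.count 0) :
    sym W ∈ rel ⊔ lowerSpan W := by
  rw [show sym W = invGen W + toQ (sigmaSubst W) from (sub_add_cancel _ _).symm]
  exact Submodule.add_mem _ (Submodule.mem_sup_left (mem_rel_of_isGen (IsGen.inv hW)))
    (Submodule.mem_sup_right (toQ_sigmaSubst_mem_lowerSpan hW h))

end Summit.KontsevichZagierPeriods.OctahedralSymmetry.OctaSpan

end
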